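/-
Origin: expansion seat `planner-pub-hodgecm-carver-g2-0`, handover #4 2026-08-18T05:09:26Z (`HOME/pub-hodgecm-carver-g2/lean/CarverG2/PerL34/AssemblyRoutes.lean`, md5 bae41223, 101 lines);
landed by the gen-6 packager in gate run 22 as `HodgeCM/PerL34/AssemblyRoutes.lean` (import ^import CarverG2\.PerL34\.→import HodgeCM.PerL34. ×1).
-/
/-
Origin: HOME/pub-hodgecm-carver-g2/lean/CarverG2/PerL34/AssemblyRoutes.lean — session planner-pub-hodgecm-carver-g2-0
(unit pub-hodgecm-carver-g2, THE CARVER gen 2).  Intended final place: `HodgeCM/PerL34/AssemblyRoutes.lean`.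

KIND: KERNEL glue (L5 assembly).  NEW additive file; lands AFTER carver `AssemblyWeil.lean` v3 (c4904c1f) (hence after
`AssemblyPrint` v3, `AssemblyDict` v2, pv03 `CharSpansWeil`, pv02-g2 `CharSpans`/`QautDictionary`, pv11 `SeesawDictionary`,
pv04-g2 `ThetaSubOfLiu`).  ONE WIP import (PACKAGER: rewrite `CarverG2.PerL34.AssemblyWeil` → `HodgeCM.PerL34.AssemblyWeil`).

NOTHING is cited or posited here.  PURPOSE (LEMMAS.md v7 §2 (2′) / v8): re-key seam S3 of the carver assembly on the realisation
input `T.Open_chars` (= node N31 = `N31_chars T` by `rfl`, Lemma 4.2(b) ll. 529–532) instead of pv13's `ClusterOutputs T`.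
Every use of `ClusterOutputs` in the assembly chain goes through `open_chars_of_cluster` (pv13 `CharsAssembly`), so nothing is
lost, and the N34 assembly becomes agnostic about HOW Lemma 4.2(b) is obtained:
* ROUTE A (PerL v5 AS WRITTEN, Rallis inner product N31b–N31h): `hch := open_chars_of_cluster T h31` — theorem
  `perL_of_clusterWeilLeaves` below recovers `AssemblyWeil.perL_of_weilDictLeaves` exactly;
* ROUTE B (print-only, adv2g5-X1 / LEMMAS v7 (2′)): `hch := Li92Route.open_chars_of_print T hP` from pv13-g2's
  `Li92Bridge.lean` (run-22/23 queue; [Li92 Cor 5.5 + Thm 5.4 a), Crelle 428 p. 206] as the verbatim field `LineDict.cor55`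
  + dictionary + archimedean occurrence) — a one-line application once that file lands (kept OUT of this file so that it
  does not inherit the `ThetaCorrespondence` v3 ordering constraint);
* route A′: `hch := Li92Route.open_chars_of_analytic T hA`.

Binder census of `perL_of_openCharsWeilLeaves`: `M : U.ModelAxioms`; PRINT leaves `h07 h09a h09b h12b`,
`hM38 : U.Fact_cmInflation` (class-M candidate, Shimura 1998 §6.2 Thm 3), `hAlb : T.Fact_thetaAlbanese` ([Liu21] Prop 4.13 +
Thm 4.18; readings R1–R4 closed, pv04g3-C1); instantiation records `hbr` (pv11 `SeesawBridge`, conservative: pv08-g2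
`nonempty_bridge_iff`), `hQ` (pv02-g2 `QautBridge`, conservative: pv08-g2 `qautBridges_iff_core`), `Pc/A12/A34` (pv06 `ArchCDatum`);
`hch : T.Open_chars` (node N31, any route); `hW : CharSpansWeil.WeilStepsInput T` (pv03; S1+S2).
-/
import Summits.HodgeConjecture.HodgeCM.PerL34.AssemblyWeil

/-! PORT of `HodgeCM/PerL34/AssemblyRoutes.lean` (HodgeCMPerL run 82) — verbatim mechanical port; provenance in the PORT header line. -/

set_option autoImplicit false

noncomputable section

namespace HodgeCM
namespace PerL34
namespace AssemblyRoutes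

open HodgeCM.Prior.Perl34File HodgeCM.Prior.Perl34File.Perl34 HodgeCM.PerL34.ArchC

variable {U : Universe}

/-- **N19w BY NAME from seesaw bridges, keyed on `Open_chars`** (pv11 `SeesawDictionary.open_thetaGen12_of_bridges`). -/
theorem N19w_wedgeMem_of_bridges_chars (T : U.ThetaModel)
    (hbr : ∀ {L : CMField} {ι₁ : L →+* ℂ} (V : HermSpace3 L ι₁) (c : SeesawCtx L), T.GoodCtx ι₁ c →
      Nonempty (SeesawDictionary.SeesawBridge T V c (T.t12 V c) 0 1))
    (hch : T.Open_chars) : N19w_wedgeMem T :=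
  SeesawDictionary.open_thetaGen12_of_bridges T hbr hch

/-- **N31 is `Open_chars`** (`Chars.N31_chars := T.Open_chars`). -/
theorem N31_chars_of_openChars (T : U.ThetaModel) (hch : T.Open_chars) : N31_chars T := hch

/-- **N33 BY NAME on the Weil route, keyed on `Open_chars`**: pv02-g2 `CharSpans.open_thetaWedge_of_charSpans` with
`LevelDirected` (`HodgeCM.levelDirected`) and `N33eClosed` (pv01 `n33eClosed_holds`) discharged in-package and the span
inputs supplied by pv03 `CharSpansWeil.charSpanStepsInput_of_weil`. -/
theorem N33_wedge_of_weil_chars (T : U.ThetaModel) (hch : T.Open_chars)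
    (hW : CharSpansWeil.WeilStepsInput T) : N33_wedge T :=
  (N33_iff T).mpr (CharSpans.open_thetaWedge_of_charSpans T HodgeCM.levelDirected n33eClosed_holds hch
    (CharSpansWeil.charSpanStepsInput_of_weil T hW))

/-- **PerL (N34) with seam S3 keyed on `T.Open_chars`.**  PROVED.  Route A: `hch := open_chars_of_cluster T h31`;
route B: `hch := Li92Route.open_chars_of_print T hP` (pv13-g2 `Li92Bridge`). -/
theorem perL_of_openCharsWeilLeaves (M : U.ModelAxioms) (T : U.ThetaModel)
    (h07 : N07_hodgeRiemann20 U) (h09a : N09a_embCover T) (h09b : N09b_innerEmb T)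
    (hM38 : U.Fact_cmInflation) (hAlb : T.Fact_thetaAlbanese) (h12b : N12b_signRecipe T)
    (hbr : ∀ {L : CMField} {ι₁ : L →+* ℂ} (V : HermSpace3 L ι₁) (c : SeesawCtx L), T.GoodCtx ι₁ c →
      Nonempty (SeesawDictionary.SeesawBridge T V c (T.t12 V c) 0 1))
    (hQ : ∀ {L : CMField} {ι₁ : L →+* ℂ} (V : HermSpace3 L ι₁) (c : SeesawCtx L), T.GoodCtx ι₁ c →
      Nonempty (QautDictionary.QautBridge T V c (T.t34 V c) 2 3))
    (Pc : ∀ {L : CMField} {ι₁ : L →+* ℂ} (V : HermSpace3 L ι₁) (c : SeesawCtx L),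
      C4a.PointedCore (T.core V c))
    (A12 : ∀ {L : CMField} {ι₁ : L →+* ℂ} (V : HermSpace3 L ι₁) (c : SeesawCtx L),
      T.GoodCtx ι₁ c → Nonempty (ArchCDatum (T.core V c) (T.t12 V c) (Pc V c)))
    (A34 : ∀ {L : CMField} {ι₁ : L →+* ℂ} (V : HermSpace3 L ι₁) (c : SeesawCtx L),
      T.GoodCtx ι₁ c → Nonempty (ArchCDatum (T.core V c) (T.t34 V c) (Pc V c)))
    (hch : T.Open_chars) (hW : CharSpansWeil.WeilStepsInput T) : U.PerL :=
  perL_of_nodes'' M T h07 h09a h09b (N12a_thetaSub_of_split M T hM38 hAlb) h12b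
    (N19w_wedgeMem_of_bridges_chars T hbr hch) (N19g_genInWedgeSpan_of_bridges T hQ)
    (N29_occ_of_archC T Pc A12 A34) (N31_chars_of_openChars T hch) (N33_wedge_of_weil_chars T hch hW)

/-- **Route A recovered**: with `hch := open_chars_of_cluster T h31` this is `AssemblyWeil.perL_of_weilDictLeaves`
(same binders; the two proofs agree definitionally up to proof irrelevance). -/
theorem perL_of_clusterWeilLeaves (M : U.ModelAxioms) (T : U.ThetaModel)
    (h07 : N07_hodgeRiemann20 U) (h09a : N09a_embCover T) (h09b : N09b_innerEmb T)
    (hM38 : U.Fact_cmInflation) (hAlb : T.Fact_thetaAlbanese) (h12b : N12b_signRecipe T)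
    (hbr : ∀ {L : CMField} {ι₁ : L →+* ℂ} (V : HermSpace3 L ι₁) (c : SeesawCtx L), T.GoodCtx ι₁ c →
      Nonempty (SeesawDictionary.SeesawBridge T V c (T.t12 V c) 0 1))
    (hQ : ∀ {L : CMField} {ι₁ : L →+* ℂ} (V : HermSpace3 L ι₁) (c : SeesawCtx L), T.GoodCtx ι₁ c →
      Nonempty (QautDictionary.QautBridge T V c (T.t34 V c) 2 3))
    (Pc : ∀ {L : CMField} {ι₁ : L →+* ℂ} (V : HermSpace3 L ι₁) (c : SeesawCtx L),
      C4a.PointedCore (T.core V c))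
    (A12 : ∀ {L : CMField} {ι₁ : L →+* ℂ} (V : HermSpace3 L ι₁) (c : SeesawCtx L),
      T.GoodCtx ι₁ c → Nonempty (ArchCDatum (T.core V c) (T.t12 V c) (Pc V c)))
    (A34 : ∀ {L : CMField} {ι₁ : L →+* ℂ} (V : HermSpace3 L ι₁) (c : SeesawCtx L),
      T.GoodCtx ι₁ c → Nonempty (ArchCDatum (T.core V c) (T.t34 V c) (Pc V c)))
    (h31 : ClusterOutputs T) (hW : CharSpansWeil.WeilStepsInput T) : U.PerL :=
  perL_of_openCharsWeilLeaves M T h07 h09a h09b hM38 hAlb h12b hbr hQ Pc A12 A34 (open_chars_of_cluster T h31) hW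

end AssemblyRoutes
end PerL34
end HodgeCM

end
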